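import Literature.Probability.Percolation.PositiveAssociationIntegral
import Mathlib.Probability.Moments.Covariance
import Mathlib.Analysis.SpecialFunctions.Trigonometric.Bounds
import Mathlib.Analysis.Complex.Trigonometric
import HarnessLib

/-!
# NEWMAN'S CHARACTERISTIC-FUNCTION INEQUALITY FOR POSITIVELY ASSOCIATED (FKG) RANDOM VARIABLES
# (Newman 1980, Thm. 1): `|E e^{i Σ_j t_j Y_j} − Π_j E e^{i t_j Y_j}| ≤ 2 Σ_{j ≠ k} |t_j t_k| Cov(Y_j, Y_k)`

Claimed R42 (8)(c) in the cell INBOX at 2026-08-28T13:11:28Z by fkp-10a gen 354 (NEW CLAIM #1 of the gen), under provision (ι) (no coordinator seated since gen 272's closing line l.8385: the lane lead absorbs the registry word, silence = consent; readers fk-ref / fkt-lead / fkp-18r / fkp-10b); lineage row FO-10a-g354 (self-suggested), package g354-newmanclt, label NC-A.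
Helper file of the `fk-continuity` build cell (bschramm lane; `--supports stmt-CriticalPhenomena-4575`); builds on
p205010 (kernel theorem, internal audit signed; external expert review pending). No definitions, no named facts, no
sorries; standard axioms. UNCONDITIONAL. GENERIC: a probability measure `μ` on a preordered measurable space `Ω` with the
FKG property `IsPositivelyAssociated μ` (the tree's `Literature/Probability/Percolation/PositiveAssociation.lean`: increasing
events are positively correlated, equivalently — `IsPositivelyAssociated.integral_mul_integral_le_integral_mul` — bounded
increasing functions are), and bounded measurable increasing "random variables" `Y_j : Ω → ℝ`.

Newman's inequality (C. M. Newman, *Normal fluctuations and the FKG inequalities*, CMP 74 (1980), Thm. 1, (11)) is the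
key to the central limit theorem for FKG systems with finite susceptibility (his Thm. 2; the companion files
`NewmanCLT*.lean` prove it for translation-covariant bounded increasing lattice fields and apply it to the random-cluster
measure below `p_c(q)`). It is proved here with the constant `2 Σ_{j ≠ k}` (ordered pairs) in place of Newman's
`½ Σ_{j ≠ k}`, which is immaterial for the limit theorems, by the LIPSCHITZ-DOMINATION device: if `|L(ω') − L(ω)| ≤ Λ(ω') − Λ(ω)`
whenever `ω ≤ ω'` ("`L` is dominated by the increasing `Λ`") then `Λ ± φ∘L` is increasing for every `1`-Lipschitz `φ`,
so positive association of `(Λ ± cos L, Λ' ± cos M)` etc. gives `|Cov(φ(L), ψ(M))| ≤ Cov(Λ, Λ')`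
(`abs_covariance_le_covariance_of_dominated`); with `L = Σ_j t_j Y_j`, `Λ = Σ_j |t_j| Y_j` and `e^{ix} = cos x + i sin x`,
`|E e^{iL} e^{iM} − E e^{iL} E e^{iM}| ≤ 4 Cov(Λ, Λ')` (`norm_integral_cexp_mul_sub_mul_le`), and induction over the index
set gives THM. 1 (`norm_integral_cexp_sum_sub_prod_le`).

## References

* C. M. Newman, *Normal fluctuations and the FKG inequalities*, Comm. Math. Phys. 74 (1980) 119–128, Thm. 1 (11),
  Lemma 3. [Newman1980]
* G. Grimmett, *The Random-Cluster Model*, Springer 2006, Thm. (2.16), §4.3 Thm. (4.17)(b) (positive association of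
  the random-cluster measures, the intended application). [Grimmett2006]
-/

noncomputable section

namespace Summit.CriticalPhenomena.PercolationContinuityZ3.Theorems.FK

namespace NewmanCLT

open MeasureTheory ProbabilityTheory Complex Finset
open Literature.Probability.Percolation

variable {Ω : Type*}

section Bounded

variable [MeasurableSpace Ω] {μ : Measure Ω}

/-! ### Bounded measurable functions: integrability bookkeeping -/

/-- A bounded measurable real function on a finite measure space is in every `L^p`. [folklore] -/
theorem memLp_of_abs_le [IsFiniteMeasure μ] {f : Ω → ℝ} (hfm : Measurable f) {C : ℝ} (hC : ∀ ω, |f ω| ≤ C)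
    (p : ENNReal) : MemLp f p μ :=
  memLp_of_bounded (a := -C) (b := C) (ae_of_all _ fun ω => abs_le.1 (hC ω)) hfm.aestronglyMeasurable p

/-- A bounded measurable real function on a finite measure space is integrable. [folklore] -/
theorem integrable_of_abs_le [IsFiniteMeasure μ] {f : Ω → ℝ} (hfm : Measurable f) {C : ℝ} (hC : ∀ ω, |f ω| ≤ C) :
    Integrable f μ :=
  memLp_one_iff_integrable.1 (memLp_of_abs_le hfm hC 1)

end Bounded

section Assoc

variable [MeasurableSpace Ω] [Preorder Ω] {μ : Measure Ω}

/-! ### Positive association in covariance form -/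

/-- **FKG in covariance form**: under a positively associated probability measure, bounded measurable increasing
functions have `Cov(f, g) ≥ 0`. [cite: Newman1980, (10); Grimmett2006, Thm. (2.16)] -/
theorem covariance_nonneg_of_monotone [IsProbabilityMeasure μ] (hμ : IsPositivelyAssociated μ) {f g : Ω → ℝ}
    (hf : Monotone f) (hg : Monotone g) (hfm : Measurable f) (hgm : Measurable g) (hfb : ∃ C, ∀ ω, |f ω| ≤ C)
    (hgb : ∃ C, ∀ ω, |g ω| ≤ C) : 0 ≤ cov[f, g; μ] := by
  obtain ⟨C, hC⟩ := hfb
  obtain ⟨D, hD⟩ := hgb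
  rw [covariance_eq_sub (memLp_of_abs_le hfm hC 2) (memLp_of_abs_le hgm hD 2)]
  have h := hμ.integral_mul_integral_le_integral_mul hf hg hfm hgm ⟨C, hC⟩ ⟨D, hD⟩
  simp only [Pi.mul_apply]
  linarith

/-- **Lipschitz domination**: if `Λ ± f` and `Λ' ± g` are increasing (all four bounded measurable) then
`|Cov(f, g)| ≤ Cov(Λ, Λ')` under a positively associated probability measure — expand the four nonnegative covariances
`Cov(Λ ± f, Λ' ± g) ≥ 0`. The real-variable core of Newman's Lemma 3. [cite: Newman1980, Lemma 3] -/
theorem abs_covariance_le_covariance_of_dominated [IsProbabilityMeasure μ] (hμ : IsPositivelyAssociated μ)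
    {f g Λ Λ' : Ω → ℝ} (hfm : Measurable f) (hgm : Measurable g) (hΛm : Measurable Λ) (hΛ'm : Measurable Λ')
    (hfb : ∃ C, ∀ ω, |f ω| ≤ C) (hgb : ∃ C, ∀ ω, |g ω| ≤ C) (hΛb : ∃ C, ∀ ω, |Λ ω| ≤ C) (hΛ'b : ∃ C, ∀ ω, |Λ' ω| ≤ C)
    (h1 : Monotone fun ω => Λ ω + f ω) (h2 : Monotone fun ω => Λ ω - f ω) (h3 : Monotone fun ω => Λ' ω + g ω)
    (h4 : Monotone fun ω => Λ' ω - g ω) : |cov[f, g; μ]| ≤ cov[Λ, Λ'; μ] := by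
  obtain ⟨Cf, hCf⟩ := hfb
  obtain ⟨Cg, hCg⟩ := hgb
  obtain ⟨CΛ, hCΛ⟩ := hΛb
  obtain ⟨CΛ', hCΛ'⟩ := hΛ'b
  have bpf : ∀ ω, |Λ ω + f ω| ≤ CΛ + Cf := fun ω => (abs_add_le _ _).trans (add_le_add (hCΛ ω) (hCf ω))
  have bmf : ∀ ω, |Λ ω - f ω| ≤ CΛ + Cf := fun ω => (abs_sub _ _).trans (add_le_add (hCΛ ω) (hCf ω))
  have bpg : ∀ ω, |Λ' ω + g ω| ≤ CΛ' + Cg := fun ω => (abs_add_le _ _).trans (add_le_add (hCΛ' ω) (hCg ω))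
  have bmg : ∀ ω, |Λ' ω - g ω| ≤ CΛ' + Cg := fun ω => (abs_sub _ _).trans (add_le_add (hCΛ' ω) (hCg ω))
  have mf : MemLp f 2 μ := memLp_of_abs_le hfm hCf 2
  have mg : MemLp g 2 μ := memLp_of_abs_le hgm hCg 2
  have mΛ : MemLp Λ 2 μ := memLp_of_abs_le hΛm hCΛ 2
  have mΛ' : MemLp Λ' 2 μ := memLp_of_abs_le hΛ'm hCΛ' 2
  have c1 := covariance_nonneg_of_monotone hμ h1 h3 (hΛm.add hfm) (hΛ'm.add hgm) ⟨_, bpf⟩ ⟨_, bpg⟩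
  have c2 := covariance_nonneg_of_monotone hμ h2 h4 (hΛm.sub hfm) (hΛ'm.sub hgm) ⟨_, bmf⟩ ⟨_, bmg⟩
  have c3 := covariance_nonneg_of_monotone hμ h1 h4 (hΛm.add hfm) (hΛ'm.sub hgm) ⟨_, bpf⟩ ⟨_, bmg⟩
  have c4 := covariance_nonneg_of_monotone hμ h2 h3 (hΛm.sub hfm) (hΛ'm.add hgm) ⟨_, bmf⟩ ⟨_, bpg⟩
  have c1' : 0 ≤ cov[Λ + f, Λ' + g; μ] := c1
  have c2' : 0 ≤ cov[Λ - f, Λ' - g; μ] := c2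
  have c3' : 0 ≤ cov[Λ + f, Λ' - g; μ] := c3
  have c4' : 0 ≤ cov[Λ - f, Λ' + g; μ] := c4
  rw [covariance_add_left mΛ mf (mΛ'.add mg), covariance_add_right mΛ mΛ' mg, covariance_add_right mf mΛ' mg] at c1'
  rw [covariance_sub_left mΛ mf (mΛ'.sub mg), covariance_sub_right mΛ mΛ' mg, covariance_sub_right mf mΛ' mg] at c2'
  rw [covariance_add_left mΛ mf (mΛ'.sub mg), covariance_sub_right mΛ mΛ' mg, covariance_sub_right mf mΛ' mg] at c3'
  rw [covariance_sub_left mΛ mf (mΛ'.add mg), covariance_add_right mΛ mΛ' mg, covariance_add_right mf mΛ' mg] at c4'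
  rw [abs_le]
  constructor <;> linarith

end Assoc

section Domination

variable [Preorder Ω]

/-! ### Domination of a function by an increasing one -/

/-- If `L` is dominated by `Λ` (`|L ω' − L ω| ≤ Λ ω' − Λ ω` for `ω ≤ ω'`) and `φ` is `1`-Lipschitz, then `Λ + φ ∘ L`
is increasing. [cite: Newman1980, Lemma 3 (proof)] -/
theorem monotone_add_comp_of_dominated {L Λ : Ω → ℝ} (hL : ∀ ⦃ω ω'⦄, ω ≤ ω' → |L ω' - L ω| ≤ Λ ω' - Λ ω)
    {φ : ℝ → ℝ} (hφ : ∀ a b, |φ a - φ b| ≤ |a - b|) : Monotone fun ω => Λ ω + φ (L ω) := by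
  intro ω ω' hle
  have h1 := hL hle
  have h2 := hφ (L ω') (L ω)
  have h3 := neg_abs_le (φ (L ω') - φ (L ω))
  dsimp only
  linarith

/-- If `L` is dominated by `Λ` and `φ` is `1`-Lipschitz, then `Λ − φ ∘ L` is increasing.
[cite: Newman1980, Lemma 3 (proof)] -/
theorem monotone_sub_comp_of_dominated {L Λ : Ω → ℝ} (hL : ∀ ⦃ω ω'⦄, ω ≤ ω' → |L ω' - L ω| ≤ Λ ω' - Λ ω)
    {φ : ℝ → ℝ} (hφ : ∀ a b, |φ a - φ b| ≤ |a - b|) : Monotone fun ω => Λ ω - φ (L ω) := by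
  intro ω ω' hle
  have h1 := hL hle
  have h2 := hφ (L ω') (L ω)
  have h3 := le_abs_self (φ (L ω') - φ (L ω))
  dsimp only
  linarith

/-- A dominating function is itself increasing. [folklore] -/
theorem monotone_of_dominated {L Λ : Ω → ℝ} (hL : ∀ ⦃ω ω'⦄, ω ≤ ω' → |L ω' - L ω| ≤ Λ ω' - Λ ω) : Monotone Λ :=
  fun _ _ hle => sub_nonneg.1 ((abs_nonneg _).trans (hL hle))

/-- An increasing function scaled by `t` is dominated by itself scaled by `|t|`. [folklore] -/
theorem dominated_mul_of_monotone {Y : Ω → ℝ} (hY : Monotone Y) (t : ℝ) :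
    ∀ ⦃ω ω'⦄, ω ≤ ω' → |t * Y ω' - t * Y ω| ≤ |t| * Y ω' - |t| * Y ω := by
  intro ω ω' hle
  rw [← mul_sub, ← mul_sub, abs_mul, abs_of_nonneg (sub_nonneg.2 (hY hle))]

/-- **Linear forms in increasing variables are dominated**: `L = Σ_{j∈s} t_j Y_j` is dominated by
`Λ = Σ_{j∈s} |t_j| Y_j`. [cite: Newman1980, Thm. 1 (proof)] -/
theorem dominated_sum_mul {ι : Type*} (s : Finset ι) {Y : ι → Ω → ℝ} (hY : ∀ j ∈ s, Monotone (Y j)) (t : ι → ℝ) :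
    ∀ ⦃ω ω'⦄, ω ≤ ω' →
      |∑ j ∈ s, t j * Y j ω' - ∑ j ∈ s, t j * Y j ω| ≤ ∑ j ∈ s, |t j| * Y j ω' - ∑ j ∈ s, |t j| * Y j ω := by
  intro ω ω' hle
  rw [← Finset.sum_sub_distrib, ← Finset.sum_sub_distrib]
  refine (Finset.abs_sum_le_sum_abs _ _).trans (Finset.sum_le_sum fun j hj => ?_)
  exact dominated_mul_of_monotone (hY j hj) (t j) hle

end Domination

section CexpIntegral

variable [MeasurableSpace Ω] {μ : Measure Ω}

/-! ### Complex exponentials of dominated functions -/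

/-- `e^{ix} = cos x + i sin x` with real `cos`, `sin`. [folklore] -/
theorem cexp_ofReal_mul_I (x : ℝ) : cexp ((x : ℂ) * I) = (Real.cos x : ℂ) + (Real.sin x : ℂ) * I := by
  rw [exp_mul_I, Complex.ofReal_cos, Complex.ofReal_sin]

/-- `∫ e^{iL} dμ = ∫ cos L dμ + i ∫ sin L dμ` for bounded measurable real `L`. [folklore] -/
theorem integral_cexp_mul_I_eq [IsFiniteMeasure μ] {L : Ω → ℝ} (hLm : Measurable L) :
    ∫ ω, cexp ((L ω : ℂ) * I) ∂μ = ((∫ ω, Real.cos (L ω) ∂μ : ℝ) : ℂ) + ((∫ ω, Real.sin (L ω) ∂μ : ℝ) : ℂ) * I := by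
  simp_rw [cexp_ofReal_mul_I]
  have hc : Integrable (fun ω => ((Real.cos (L ω) : ℝ) : ℂ)) μ :=
    (integrable_of_abs_le (Real.measurable_cos.comp hLm) fun ω => Real.abs_cos_le_one _).ofReal
  have hs : Integrable (fun ω => ((Real.sin (L ω) : ℝ) : ℂ) * I) μ :=
    ((integrable_of_abs_le (Real.measurable_sin.comp hLm) fun ω => Real.abs_sin_le_one _).ofReal).mul_const _
  rw [integral_add hc hs, integral_mul_const, integral_complex_ofReal, integral_complex_ofReal]

/-- `‖∫ e^{iL} dμ‖ ≤ 1` on a probability space. [folklore] -/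
theorem norm_integral_cexp_mul_I_le_one [IsProbabilityMeasure μ] (L : Ω → ℝ) :
    ‖∫ ω, cexp ((L ω : ℂ) * I) ∂μ‖ ≤ 1 := by
  refine (norm_integral_le_of_norm_le_const (C := 1) (ae_of_all _ fun ω => ?_)).trans (by simp)
  rw [norm_exp_ofReal_mul_I]

end CexpIntegral

section Newman

variable [MeasurableSpace Ω] [Preorder Ω] {μ : Measure Ω}

/-- **Newman's Lemma 3, complex-exponential form** (constant `4`): if `L`, `M` are dominated by the bounded
measurable increasing `Λ`, `Λ'`, then `‖E[e^{iL} e^{iM}] − E[e^{iL}] E[e^{iM}]‖ ≤ 4 Cov(Λ, Λ')` under a positively associated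
probability measure (`cos`, `sin` are `1`-Lipschitz; the four real covariances are each bounded by `Cov(Λ, Λ')`).
[cite: Newman1980, Lemma 3] -/
theorem norm_integral_cexp_mul_sub_mul_le [IsProbabilityMeasure μ] (hμ : IsPositivelyAssociated μ)
    {L M Λ Λ' : Ω → ℝ} (hLm : Measurable L) (hMm : Measurable M) (hΛm : Measurable Λ) (hΛ'm : Measurable Λ')
    (hΛb : ∃ C, ∀ ω, |Λ ω| ≤ C) (hΛ'b : ∃ C, ∀ ω, |Λ' ω| ≤ C)
    (hL : ∀ ⦃ω ω'⦄, ω ≤ ω' → |L ω' - L ω| ≤ Λ ω' - Λ ω) (hM : ∀ ⦃ω ω'⦄, ω ≤ ω' → |M ω' - M ω| ≤ Λ' ω' - Λ' ω) :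
    ‖∫ ω, cexp ((L ω : ℂ) * I) * cexp ((M ω : ℂ) * I) ∂μ -
        (∫ ω, cexp ((L ω : ℂ) * I) ∂μ) * (∫ ω, cexp ((M ω : ℂ) * I) ∂μ)‖ ≤ 4 * cov[Λ, Λ'; μ] := by
  -- the four real ingredients
  set c₁ : Ω → ℝ := fun ω => Real.cos (L ω)
  set s₁ : Ω → ℝ := fun ω => Real.sin (L ω)
  set c₂ : Ω → ℝ := fun ω => Real.cos (M ω)
  set s₂ : Ω → ℝ := fun ω => Real.sin (M ω)
  have hc₁m : Measurable c₁ := Real.measurable_cos.comp hLm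
  have hs₁m : Measurable s₁ := Real.measurable_sin.comp hLm
  have hc₂m : Measurable c₂ := Real.measurable_cos.comp hMm
  have hs₂m : Measurable s₂ := Real.measurable_sin.comp hMm
  have hc₁b : ∀ ω, |c₁ ω| ≤ 1 := fun ω => Real.abs_cos_le_one _
  have hs₁b : ∀ ω, |s₁ ω| ≤ 1 := fun ω => Real.abs_sin_le_one _
  have hc₂b : ∀ ω, |c₂ ω| ≤ 1 := fun ω => Real.abs_cos_le_one _
  have hs₂b : ∀ ω, |s₂ ω| ≤ 1 := fun ω => Real.abs_sin_le_one _
  have cosL : ∀ a b : ℝ, |Real.cos a - Real.cos b| ≤ |a - b| := Real.abs_cos_sub_cos_le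
  have sinL : ∀ a b : ℝ, |Real.sin a - Real.sin b| ≤ |a - b| := Real.abs_sin_sub_sin_le
  have bcc := abs_covariance_le_covariance_of_dominated hμ hc₁m hc₂m hΛm hΛ'm ⟨1, hc₁b⟩ ⟨1, hc₂b⟩ hΛb hΛ'b
    (monotone_add_comp_of_dominated hL cosL) (monotone_sub_comp_of_dominated hL cosL)
    (monotone_add_comp_of_dominated hM cosL) (monotone_sub_comp_of_dominated hM cosL)
  have bss := abs_covariance_le_covariance_of_dominated hμ hs₁m hs₂m hΛm hΛ'm ⟨1, hs₁b⟩ ⟨1, hs₂b⟩ hΛb hΛ'b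
    (monotone_add_comp_of_dominated hL sinL) (monotone_sub_comp_of_dominated hL sinL)
    (monotone_add_comp_of_dominated hM sinL) (monotone_sub_comp_of_dominated hM sinL)
  have bcs := abs_covariance_le_covariance_of_dominated hμ hc₁m hs₂m hΛm hΛ'm ⟨1, hc₁b⟩ ⟨1, hs₂b⟩ hΛb hΛ'b
    (monotone_add_comp_of_dominated hL cosL) (monotone_sub_comp_of_dominated hL cosL)
    (monotone_add_comp_of_dominated hM sinL) (monotone_sub_comp_of_dominated hM sinL)
  have bsc := abs_covariance_le_covariance_of_dominated hμ hs₁m hc₂m hΛm hΛ'm ⟨1, hs₁b⟩ ⟨1, hc₂b⟩ hΛb hΛ'b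
    (monotone_add_comp_of_dominated hL sinL) (monotone_sub_comp_of_dominated hL sinL)
    (monotone_add_comp_of_dominated hM cosL) (monotone_sub_comp_of_dominated hM cosL)
  -- covariances as differences of integrals
  have m1 : ∀ {u : Ω → ℝ}, Measurable u → (∀ ω, |u ω| ≤ 1) → MemLp u 2 μ := fun hu hb => memLp_of_abs_le hu hb 2
  have i1 : ∀ {u : Ω → ℝ}, Measurable u → (∀ ω, |u ω| ≤ 1) → Integrable u μ := fun hu hb => integrable_of_abs_le hu hb
  have ecc := covariance_eq_sub (m1 hc₁m hc₁b) (m1 hc₂m hc₂b)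
  have ess := covariance_eq_sub (m1 hs₁m hs₁b) (m1 hs₂m hs₂b)
  have ecs := covariance_eq_sub (m1 hc₁m hc₁b) (m1 hs₂m hs₂b)
  have esc := covariance_eq_sub (m1 hs₁m hs₁b) (m1 hc₂m hc₂b)
  simp only [Pi.mul_apply] at ecc ess ecs esc
  -- the integral of the product
  have hprod : ∀ ω, cexp ((L ω : ℂ) * I) * cexp ((M ω : ℂ) * I) =
      ((c₁ ω * c₂ ω - s₁ ω * s₂ ω : ℝ) : ℂ) + ((c₁ ω * s₂ ω + s₁ ω * c₂ ω : ℝ) : ℂ) * I := by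
    intro ω
    rw [cexp_ofReal_mul_I, cexp_ofReal_mul_I]
    apply Complex.ext <;> simp [c₁, c₂, s₁, s₂]
  have imul : ∀ {u v : Ω → ℝ}, Measurable u → Measurable v → (∀ ω, |u ω| ≤ 1) → (∀ ω, |v ω| ≤ 1) →
      Integrable (fun ω => u ω * v ω) μ := fun hu hv hub hvb =>
    (i1 hv hvb).bdd_mul hu.aestronglyMeasurable (ae_of_all _ fun ω => by rw [Real.norm_eq_abs]; exact hub ω)
  have hcc := imul hc₁m hc₂m hc₁b hc₂b
  have hss := imul hs₁m hs₂m hs₁b hs₂b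
  have hcs := imul hc₁m hs₂m hc₁b hs₂b
  have hsc := imul hs₁m hc₂m hs₁b hc₂b
  have hint : ∫ ω, cexp ((L ω : ℂ) * I) * cexp ((M ω : ℂ) * I) ∂μ =
      ((∫ ω, (c₁ ω * c₂ ω - s₁ ω * s₂ ω) ∂μ : ℝ) : ℂ) + ((∫ ω, (c₁ ω * s₂ ω + s₁ ω * c₂ ω) ∂μ : ℝ) : ℂ) * I := by
    simp_rw [hprod]
    rw [integral_add (hcc.sub hss).ofReal ((hcs.add hsc).ofReal.mul_const _), integral_mul_const,
      integral_complex_ofReal, integral_complex_ofReal]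
  rw [hint, integral_sub hcc hss, integral_add hcs hsc, integral_cexp_mul_I_eq hLm, integral_cexp_mul_I_eq hMm]
  -- the difference is `(Cov(c₁,c₂) − Cov(s₁,s₂)) + i (Cov(c₁,s₂) + Cov(s₁,c₂))`
  have hre : (( ((∫ ω, c₁ ω * c₂ ω ∂μ) - ∫ ω, s₁ ω * s₂ ω ∂μ : ℝ) : ℂ) +
        (((∫ ω, c₁ ω * s₂ ω ∂μ) + ∫ ω, s₁ ω * c₂ ω ∂μ : ℝ) : ℂ) * I -
        ((((∫ ω, c₁ ω ∂μ : ℝ)) : ℂ) + ((∫ ω, s₁ ω ∂μ : ℝ) : ℂ) * I) *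
          ((((∫ ω, c₂ ω ∂μ : ℝ)) : ℂ) + ((∫ ω, s₂ ω ∂μ : ℝ) : ℂ) * I)) =
      ((cov[c₁, c₂; μ] - cov[s₁, s₂; μ] : ℝ) : ℂ) + ((cov[c₁, s₂; μ] + cov[s₁, c₂; μ] : ℝ) : ℂ) * I := by
    rw [ecc, ess, ecs, esc]
    apply Complex.ext <;> simp <;> ring
  rw [hre]
  refine (norm_le_abs_re_add_abs_im _).trans ?_
  have hre' : (((cov[c₁, c₂; μ] - cov[s₁, s₂; μ] : ℝ) : ℂ) + ((cov[c₁, s₂; μ] + cov[s₁, c₂; μ] : ℝ) : ℂ) * I).re =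
      cov[c₁, c₂; μ] - cov[s₁, s₂; μ] := by simp
  have him' : (((cov[c₁, c₂; μ] - cov[s₁, s₂; μ] : ℝ) : ℂ) + ((cov[c₁, s₂; μ] + cov[s₁, c₂; μ] : ℝ) : ℂ) * I).im =
      cov[c₁, s₂; μ] + cov[s₁, c₂; μ] := by simp
  rw [hre', him']
  have t1 := abs_sub (cov[c₁, c₂; μ]) (cov[s₁, s₂; μ])
  have t2 := abs_add_le (cov[c₁, s₂; μ]) (cov[s₁, c₂; μ])
  linarith

/-! ### Newman's Theorem 1 -/

/-- **NEWMAN'S INEQUALITY** (1980, Thm. 1, (11), with the constant `2 Σ_{j ≠ k}` over ordered pairs): for bounded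
measurable increasing `Y_j`, `j ∈ s`, under a positively associated probability measure and real `t_j`,
`‖E exp(i Σ_{j∈s} t_j Y_j) − Π_{j∈s} E exp(i t_j Y_j)‖ ≤ 2 Σ_{j∈s} Σ_{k∈s, k≠j} |t_j| |t_k| Cov(Y_j, Y_k)`.
Induction on `s`: `e^{i(L + t_a Y_a)} = e^{iL} e^{i t_a Y_a}`, Lemma 3 for the pair (`L` dominated by `Σ|t_j|Y_j`), and
bilinearity of the covariance. [cite: Newman1980, Thm. 1 (11)] -/
theorem norm_integral_cexp_sum_sub_prod_le [IsProbabilityMeasure μ] (hμ : IsPositivelyAssociated μ) {ι : Type*}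
    [DecidableEq ι] (s : Finset ι) {Y : ι → Ω → ℝ} (hYm : ∀ j ∈ s, Measurable (Y j)) (hYmono : ∀ j ∈ s, Monotone (Y j))
    (hYb : ∀ j ∈ s, ∃ C, ∀ ω, |Y j ω| ≤ C) (t : ι → ℝ) :
    ‖∫ ω, cexp (((∑ j ∈ s, t j * Y j ω : ℝ) : ℂ) * I) ∂μ - ∏ j ∈ s, ∫ ω, cexp (((t j * Y j ω : ℝ) : ℂ) * I) ∂μ‖ ≤
      2 * ∑ j ∈ s, ∑ k ∈ s.erase j, |t j| * |t k| * cov[Y j, Y k; μ] := by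
  induction s using Finset.induction_on with
  | empty => simp
  | insert a s ha ih =>
    have hYm' : ∀ j ∈ s, Measurable (Y j) := fun j hj => hYm j (mem_insert_of_mem hj)
    have hYmono' : ∀ j ∈ s, Monotone (Y j) := fun j hj => hYmono j (mem_insert_of_mem hj)
    have hYb' : ∀ j ∈ s, ∃ C, ∀ ω, |Y j ω| ≤ C := fun j hj => hYb j (mem_insert_of_mem hj)
    have IH := ih hYm' hYmono' hYb'
    have ham : Measurable (Y a) := hYm a (mem_insert_self a s)
    have hamono : Monotone (Y a) := hYmono a (mem_insert_self a s)
    obtain ⟨Ca, hCa⟩ := hYb a (mem_insert_self a s)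
    -- the pieces: `L = Σ_{j∈s} t_j Y_j`, `Λ = Σ_{j∈s} |t_j| Y_j`, `M = t_a Y_a`, `Λ' = |t_a| Y_a`
    set L : Ω → ℝ := fun ω => ∑ j ∈ s, t j * Y j ω with hLdef
    set Λ : Ω → ℝ := fun ω => ∑ j ∈ s, |t j| * Y j ω with hΛdef
    have hLm : Measurable L := Finset.measurable_sum _ fun j hj => (hYm' j hj).const_mul _
    have hΛm : Measurable Λ := Finset.measurable_sum _ fun j hj => (hYm' j hj).const_mul _
    have hMm : Measurable fun ω => t a * Y a ω := ham.const_mul _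
    have hΛ'm : Measurable fun ω => |t a| * Y a ω := ham.const_mul _
    -- bounds
    choose! C hC using hYb'
    have hΛb : ∃ B, ∀ ω, |Λ ω| ≤ B := by
      refine ⟨∑ j ∈ s, |t j| * C j, fun ω => (Finset.abs_sum_le_sum_abs _ _).trans (Finset.sum_le_sum fun j hj => ?_)⟩
      rw [abs_mul, abs_abs]
      exact mul_le_mul_of_nonneg_left (hC j hj ω) (abs_nonneg _)
    have hΛ'b : ∃ B, ∀ ω, |(|t a| * Y a ω)| ≤ B :=
      ⟨|t a| * Ca, fun ω => by rw [abs_mul, abs_abs]; exact mul_le_mul_of_nonneg_left (hCa ω) (abs_nonneg _)⟩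
    have hdomL : ∀ ⦃ω ω'⦄, ω ≤ ω' → |L ω' - L ω| ≤ Λ ω' - Λ ω := dominated_sum_mul s hYmono' t
    have hdomM : ∀ ⦃ω ω'⦄, ω ≤ ω' → |t a * Y a ω' - t a * Y a ω| ≤ |t a| * Y a ω' - |t a| * Y a ω :=
      dominated_mul_of_monotone hamono (t a)
    have key := norm_integral_cexp_mul_sub_mul_le hμ hLm hMm hΛm hΛ'm hΛb hΛ'b hdomL hdomM
    -- `Cov(Λ, |t_a| Y_a) = |t_a| Σ_j |t_j| Cov(Y_j, Y_a)`
    have m2 : ∀ j ∈ insert a s, MemLp (Y j) 2 μ := fun j hj => by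
      obtain ⟨Cj, hCj⟩ := hYb j hj
      exact memLp_of_abs_le (hYm j hj) hCj 2
    have hcov : cov[Λ, fun ω => |t a| * Y a ω; μ] = |t a| * ∑ j ∈ s, |t j| * cov[Y j, Y a; μ] := by
      rw [covariance_const_mul_right, hΛdef, covariance_fun_sum_left' (fun j hj =>
        (m2 j (mem_insert_of_mem hj)).const_mul _) (m2 a (mem_insert_self a s))]
      congr 1
      refine Finset.sum_congr rfl fun j _ => ?_
      rw [covariance_const_mul_left]
    -- split the exponential of the sum
    have hsplit : ∀ ω, cexp (((∑ j ∈ insert a s, t j * Y j ω : ℝ) : ℂ) * I) =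
        cexp ((L ω : ℂ) * I) * cexp (((t a * Y a ω : ℝ) : ℂ) * I) := by
      intro ω
      rw [Finset.sum_insert ha, ← Complex.exp_add]
      congr 1
      simp only [hLdef]
      push_cast
      ring
    simp_rw [hsplit]
    rw [Finset.prod_insert ha]
    -- telescoping: `∫ e^{iL} e^{iM} − Π = (∫ e^{iL}e^{iM} − ∫e^{iL} ∫e^{iM}) + (∫ e^{iL} − Π_s) ∫ e^{iM}`
    have htel : ∫ ω, cexp ((L ω : ℂ) * I) * cexp (((t a * Y a ω : ℝ) : ℂ) * I) ∂μ -
          (∫ ω, cexp (((t a * Y a ω : ℝ) : ℂ) * I) ∂μ) * ∏ j ∈ s, ∫ ω, cexp (((t j * Y j ω : ℝ) : ℂ) * I) ∂μ =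
        (∫ ω, cexp ((L ω : ℂ) * I) * cexp (((t a * Y a ω : ℝ) : ℂ) * I) ∂μ -
            (∫ ω, cexp ((L ω : ℂ) * I) ∂μ) * ∫ ω, cexp (((t a * Y a ω : ℝ) : ℂ) * I) ∂μ) +
          (∫ ω, cexp ((L ω : ℂ) * I) ∂μ - ∏ j ∈ s, ∫ ω, cexp (((t j * Y j ω : ℝ) : ℂ) * I) ∂μ) *
            ∫ ω, cexp (((t a * Y a ω : ℝ) : ℂ) * I) ∂μ := by ring
    rw [htel]
    refine (norm_add_le _ _).trans ?_
    rw [norm_mul]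
    have hIH' : ‖∫ ω, cexp ((L ω : ℂ) * I) ∂μ - ∏ j ∈ s, ∫ ω, cexp (((t j * Y j ω : ℝ) : ℂ) * I) ∂μ‖ *
        ‖∫ ω, cexp (((t a * Y a ω : ℝ) : ℂ) * I) ∂μ‖ ≤ 2 * ∑ j ∈ s, ∑ k ∈ s.erase j, |t j| * |t k| * cov[Y j, Y k; μ] := by
      refine (mul_le_of_le_one_right (norm_nonneg _) (norm_integral_cexp_mul_I_le_one _)).trans ?_
      simpa [hLdef] using IH
    refine (add_le_add (key.trans (le_of_eq (by rw [hcov]))) hIH').trans (le_of_eq ?_)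
    -- bookkeeping of the double sum over `insert a s`
    rw [Finset.sum_insert ha, Finset.erase_insert ha]
    have hinner : ∀ j ∈ s, ∑ k ∈ (insert a s).erase j, |t j| * |t k| * cov[Y j, Y k; μ] =
        |t j| * |t a| * cov[Y j, Y a; μ] + ∑ k ∈ s.erase j, |t j| * |t k| * cov[Y j, Y k; μ] := by
      intro j hj
      have hja : j ≠ a := fun h => ha (h ▸ hj)
      rw [Finset.erase_insert_of_ne hja.symm, Finset.sum_insert (fun h => ha (Finset.mem_of_mem_erase h))]
    rw [Finset.sum_congr rfl hinner, Finset.sum_add_distrib]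
    have hS1 : ∑ k ∈ s, |t a| * |t k| * cov[Y a, Y k; μ] = |t a| * ∑ j ∈ s, |t j| * cov[Y j, Y a; μ] := by
      rw [Finset.mul_sum]
      refine Finset.sum_congr rfl fun k _ => ?_
      rw [covariance_comm]
      ring
    have hS2 : ∑ j ∈ s, |t j| * |t a| * cov[Y j, Y a; μ] = |t a| * ∑ j ∈ s, |t j| * cov[Y j, Y a; μ] := by
      rw [Finset.mul_sum]
      refine Finset.sum_congr rfl fun k _ => ?_
      ring
    rw [hS1, hS2]
    ring

end Newman

end NewmanCLT

end Summit.CriticalPhenomena.PercolationContinuityZ3.Theorems.FK
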